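import Mathlib
import HarnessLib

/-!
# The coefficients of `det (s A + G)` for `A ⪰ 0`, `G ≻ 0` are non-negative

Topic `Literature/LinearAlgebra/Matrix`. For complex Hermitian matrices `A` positive semidefinite
and `G` positive definite, every coefficient of the polynomial `s ↦ det (s A + G)` is a
non-negative real number (these coefficients are, up to binomial factors, the mixed discriminants
`D(A, …, A, G, …, G)`; used for the positivity of the Monge–Ampère densities
`(dd^c g)^j ∧ ω_FS^{N-j}` in `Literature/Analysis/Pluripotential`). Proof: with `R = G^{1/2}`
(continuous functional calculus) one has `s A + G = R (s M + 1) R`, `M = R⁻¹ A R⁻¹ ⪰ 0`, and the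
`k`-th coefficient of `det (1 + s M)` is the sum of the `k × k` principal minors of `M`
(Mathlib's `Matrix.coeff_det_one_add_X_smul_eq_sum_minors`), each `≥ 0`.

## Main results

* `coeff_det_one_add_X_smul_nonneg` — `0 ≤ [s^k] det (1 + s M)` for `M ⪰ 0`.
* `coeff_det_X_smul_add_nonneg` — `0 ≤ [s^k] det (s A + G)` for `A ⪰ 0`, `G ≻ 0` (in the star
  order of `ℂ`: real and non-negative), and its real-part form `coeff_det_X_smul_add_re_nonneg`.

## References

Standard linear algebra (mixed discriminants of positive semidefinite Hermitian matrices are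
non-negative); e.g. R. Bhatia, Matrix Analysis (1997), §V / L. Hörmander, Notions of Convexity
(1994), §2.1 for hyperbolicity of `det`. [folklore]
-/

noncomputable section

open scoped ComplexOrder Matrix MatrixOrder Polynomial
open Matrix Polynomial

namespace Literature.LinearAlgebra.Matrix

variable {n : Type*} [Fintype n] [DecidableEq n]

/-- For a positive semidefinite complex matrix `M`, every coefficient of `det (1 + s M)` is
non-negative: it is the sum of the `k × k` principal minors of `M`. [folklore] -/
theorem coeff_det_one_add_X_smul_nonneg {M : Matrix n n ℂ} (hM : M.PosSemidef) (k : ℕ) :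
    0 ≤ (det (1 + (X : ℂ[X]) • M.map C)).coeff k := by
  rw [coeff_det_one_add_X_smul_eq_sum_minors]
  exact Finset.sum_nonneg fun s _ ↦ (hM.submatrix _).det_nonneg

/-- **Non-negativity of the coefficients of `det (s A + G)`** for `A` positive semidefinite and
`G` positive definite (complex Hermitian matrices): `0 ≤ [s^k] det (s A + G)` in the star order of
`ℂ` (i.e. the coefficient is real and `≥ 0`). Proof: `s A + G = R (s M + 1) R` with `R = √G`,
`M = R⁻¹ A R⁻¹ ⪰ 0`, and `coeff_det_one_add_X_smul_nonneg`. [folklore] -/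
theorem coeff_det_X_smul_add_nonneg {A G : Matrix n n ℂ} (hA : A.PosSemidef) (hG : G.PosDef)
    (k : ℕ) : 0 ≤ (det ((X : ℂ[X]) • A.map C + G.map C)).coeff k := by
  -- the square root of `G`
  set R : Matrix n n ℂ := CFC.sqrt G with hR
  have hG0 : (0 : Matrix n n ℂ) ≤ G := hG.posSemidef.nonneg
  have hRR : R * R = G := CFC.sqrt_mul_sqrt_self G hG0
  have hRpsd : R.PosSemidef := (CFC.sqrt_nonneg G).posSemidef
  have hRherm : Rᴴ = R := hRpsd.1
  have hRdet : IsUnit R.det := by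
    rw [isUnit_iff_ne_zero]
    intro h
    have : G.det = 0 := by rw [← hRR, det_mul, h, zero_mul]
    exact hG.det_pos.ne' this
  -- `M = R⁻¹ A R⁻¹ ⪰ 0`
  set M : Matrix n n ℂ := R⁻¹ * A * R⁻¹ with hM
  have hMpsd : M.PosSemidef := by
    have := hA.conjTranspose_mul_mul_same R⁻¹
    rwa [conjTranspose_nonsing_inv, hRherm] at this
  have hA' : A = R * M * R := by
    rw [hM, ← Matrix.mul_assoc, ← Matrix.mul_assoc, mul_nonsing_inv _ hRdet, Matrix.one_mul,
      Matrix.mul_assoc, nonsing_inv_mul _ hRdet, Matrix.mul_one]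
  -- the factorisation of the pencil
  have key : (X : ℂ[X]) • A.map C + G.map C =
      R.map C * ((X : ℂ[X]) • M.map C + 1) * R.map C := by
    rw [Matrix.mul_add, Matrix.add_mul, Matrix.mul_one, Matrix.mul_smul, Matrix.smul_mul,
      ← Matrix.map_mul, ← Matrix.map_mul, ← hA', ← Matrix.map_mul, hRR]
  have hdetR : (R.map C).det = C R.det := (RingHom.map_det C R).symm
  rw [key, det_mul, det_mul, hdetR, coeff_mul_C, coeff_C_mul, add_comm]
  exact mul_nonneg (mul_nonneg hRpsd.det_nonneg (coeff_det_one_add_X_smul_nonneg hMpsd k))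
    hRpsd.det_nonneg

/-- Real-part form of `coeff_det_X_smul_add_nonneg`: `0 ≤ Re [s^k] det (s A + G)` (and the
imaginary part vanishes). [folklore] -/
theorem coeff_det_X_smul_add_re_nonneg {A G : Matrix n n ℂ} (hA : A.PosSemidef) (hG : G.PosDef)
    (k : ℕ) : 0 ≤ ((det ((X : ℂ[X]) • A.map C + G.map C)).coeff k).re ∧
      ((det ((X : ℂ[X]) • A.map C + G.map C)).coeff k).im = 0 := by
  have h := Complex.nonneg_iff.mp (coeff_det_X_smul_add_nonneg hA hG k)
  exact ⟨h.1, h.2.symm⟩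

end Literature.LinearAlgebra.Matrix

end
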